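import Summits.Ventures.CertifiedManyBodySolver.Downfold.BoxesHg1201EStationKinematics
import Summits.Ventures.CertifiedManyBodySolver.Observables.StiffnessApexTransportTargetSlot
import Summits.Ventures.CertifiedManyBodySolver.Observables.StiffnessTPrimeSegmentLeaf
import HarnessLib

/-!
# BOX-READ, GENERIC «Q-FREE» STATION CLOSERS — the inner END objective of a target-slot station is STATE-FREE whenever its half-bathtub reading
# at the top density is under the word; the box then needs ONE certified family (`P` on the whole station segment) or TWO (`P` on the overhang,
# the OWN word on the inner segment)

Venture CertifiedManyBodySolver; cell `hubbard-obs` / D-0154 (1)(C) COVERAGE; seat `hubbard-cov-la214-box-2` (`prover-hubbard-cov-la214-box-2-g0-0`, g1).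
The material-independent form of this seat's `Downfold/BoxesLa214V115M2cBoxReadQFree.lean` (p635775, La214 M2(c); captain cov-la214-plan-1 13:12:20Z: edition of
record) and `Downfold/BoxesNdNiO2M21QRowsKinematic.lean` (p636407, NdNiO₂ M21; captain cov-ndnio2-plan-1 D17/D17b), and of hubbard-cov-hg1201-box-2's
`Downfold/BoxesHg1201EStationKinematics.lean` §3–§4 (Hg-1201): every one of them strikes the `Q = −X₀(q, U_A)` rows of a two-END-objective station plan
(`Observables/StiffnessApexTransportTargetSlot.lean` §5, unc-2 g15) by the same one-body fact. Stated ONCE here for any box, so the next column (LBCO M107–M109,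
La214 M14/M16/M17/M50, Hg-1223, CCOC, …) needs one kernel half-bathtub row and one `exact`, not a file.

THE MECHANISM (numbers are the caller's). Station `0 < U_A ≤ U_max`, target box `[p, q] × [U_A, U_max] × [n₁, n₂]` (`p < q ≤ 0`, `0 ≤ n₁`, `n₂ < 2`); a
target `(σ, U, x)` is read at the source `(U_A, s)`, `s = σ(2U − U_A)/U ∈ [σ(2 − U_A/U_max), σ]`, with the objective `−X₀(σ, U_A)`
(`ObsStiffnessSeqCeilingAt_on_box3_of_apexStation_targetSlot`). The orbit mean of `−X₀(σ, U_A)` is AFFINE in the slot `σ`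
(`orbitLower_slot_chord_of_two_endObjectives`), and for the END slot `q` it is bounded below on EVERY torus-limit sector-ground-state class of density `x` by
the one-body number `−(ν·x/2 + B)` whenever `B(q, ν) ≤ B` (`orbitMean_neg_oddMomentTT_lam_zero_ge_kinematic_of_gs`, the torus-limit variational inequality;
kernel rows `halfBathtub…_le` supply `B`). Hence (§1) with `ν ≥ 0` and `ν·n₂/2 + B ≤ c` the `Q` family is the constant `−c` — STATE-FREE; and
* §2 `ObsStiffnessSeqCeilingAt_on_box3_of_apexStation_stationP_kinQ`: ONE certified family `vP x s ≤` orbit mean of `−X₀(p, U_A)` on the whole station segment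
  `s ∈ [p(2 − U_A/U_max), q]`, `−vP ≤ c` ⇒ the box word `c`;
* §3 `ObsStiffnessSeqCeilingAt_on_box3_of_apexStation_overhangP_innerOwn_kinQ`: `vP` on the OVERHANG `s ∈ [p(2 − U_A/U_max), p]` and the OWN-word family
  `vO x s ≤` orbit mean of `−X₀(s, U_A)` on the INNER segment `s ∈ [p, q]` (an inner source `s` serves the slots `σ ∈ [s, q]` = chords of the slots `s` and `q`),
  `−vP, −vO ≤ c` ⇒ the box word `c` (the M2(b)-style own-word inner bundle, doped, with no `K₂` lever); `…_overhangP_innerP_kinQ`: `P` on both pieces.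
PRICE of the trick: `c` can never be below the kinematic `Q` reading `ν·n₂/2 + B` — harmless for a rung leaf stated at a bar above it, and exactly the
situation of every D-0154 box so far (La214 M2(c): `0.4001658 < 0.4017332`; NdNiO₂ M21: `0.4768946 < 0.4779578`; Hg-1201 M19b: `0.5152137 < 0.5166800`).

Everything here is PROVED (no `sorry`, no definition, zero compute); the theorems assert nothing until a caller supplies the certified family.

HONEST FRAMING: obligation bookkeeping + a one-body (kinematic, state-free) majorant that certifies nothing about correlations; the words so closed are
one-sided stiffness-scale CEILINGS of CONTROL / CALIBRATION class (wording (xx1)) + labelled heuristic on downfolded, screening-grade one-band boxes; a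
ceiling never speaks to the presence or absence of superconductivity; never «certified true negative / positive»; not a `T_c` or phase sentence; nothing
here is a statement about any material; no item, rung leaf or summit statement is proved by this file.

References: E. H. Lieb, M. Loss, Duke Math. J. 71 (1993) 337, §8 Thm. 8.2 [LiebLoss1993]; T. Hazra, N. Verma, M. Randeria, PRX 9 (2019) 031049,
eqs. (2)–(6) [HazraVermaRanderia2019]; T. Koma, H. Tasaki, J. Stat. Phys. 76 (1994) 745, §1 [KomaTasaki1994]; D. J. Scalapino, S. R. White,
S.-C. Zhang, PRB 47 (1993) 7995, §II [ScalapinoWhiteZhang1993].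
-/

noncomputable section

namespace Summit.Ventures.CertifiedManyBodySolver.Downfold

open Set Filter Topology Real
open Summit.Ventures.CertifiedManyBodySolver.Observables
open Literature.MathematicalPhysics.QuantumLattice Literature.MathematicalPhysics.QuantumLattice.ThermodynamicLimit
open Literature.Probability.LatticeModels
open Matrix HubbardWave0
open scoped BigOperators ComplexOrder

/-! ## §1 The END slot is state-free on a filling slab -/

/-- **STATE-FREE END-SLOT WORD ON A SLAB.** Slot `q`, level `ν ≥ 0`, `B(q, ν) ≤ B`, slab top `n₂ < 2` with `ν·n₂/2 + B ≤ c`: for every density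
`0 ≤ n ≤ n₂`, every label `U_A`, every source Hamiltonian `hubbardTorusTT' L 1 s U_A'` and every torus limit of unit `(rectN n L, S^z = 0)`-sector ground
states, `−c ≤ |D₄|⁻¹ Σ_γ Re ω_γ(−X₀(q, U_A))`. [cite: LiebLoss1993, §8, Theorem 8.2] [cite: HazraVermaRanderia2019, eqs. (2)-(6)] -/
theorem orbitMean_endSlot_ge_neg_of_halfBathtub_le (q UA s UA' : ℝ) {ν B c n₂ : ℝ} (hν : 0 ≤ ν)
    (hB : (∫ y in (-π)..π, ∫ x in (-π)..π,
        max (Real.cos x + Real.cos y + 4 * q * (Real.cos x * Real.cos y) - ν) 0) / (4 * π ^ 2) ≤ B)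
    (hn₂ : n₂ < 2) (hc : ν * n₂ / 2 + B ≤ c) {n : ℝ} (hn0 : 0 ≤ n) (hn : n ≤ n₂)
    (ω : InfVolFermionState 2) (Ls : ℕ → ℕ) (ψ : ∀ L, Fock (Orb (FermionTorus 2 L)))
    (hLs : Tendsto Ls atTop atTop)
    (hψ : ∀ j, IsGroundStateInSector (hubbardTorusTT' (Ls j) 1 s UA') (rectN n (Ls j)) 0 (ψ (Ls j)))
    (h1 : ∀ j, star (ψ (Ls j)) ⬝ᵥ ψ (Ls j) = 1) (hω : ω.IsTorusLimitOf ψ Ls) :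
    -c ≤ ((Finset.univ : Finset (DihedralGroup 4)).card : ℝ)⁻¹ * ∑ g ∈ (Finset.univ : Finset (DihedralGroup 4)),
        (ω.expect (d4ShiftSet g 0 (Literature.Probability.LatticeModels.box 2 7))
          (fermionEmbed (PolySite.d4Emb g 0 (Literature.Probability.LatticeModels.box 2 7)) (-oddMomentObsTT q UA 0))).re := by
  have hkin := orbitMean_neg_oddMomentTT_lam_zero_ge_kinematic_of_gs q UA s UA' hB hn0 (lt_of_le_of_lt hn hn₂) ω Ls ψ hLs hψ h1 hω
  have hmono : ν * n / 2 + B ≤ ν * n₂ / 2 + B := by nlinarith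
  linarith

/-- Negated chord of two values each `≥ −c` is `≤ c`. [folklore] -/
private theorem neg_chord_le {w₁ w₂ v₁ v₂ c : ℝ} (hw₁ : 0 ≤ w₁) (hw₂ : 0 ≤ w₂) (hws : w₁ + w₂ = 1) (h₁ : -v₁ ≤ c)
    (h₂ : -v₂ ≤ c) : -(w₁ * v₁ + w₂ * v₂) ≤ c := by
  have k₁ := mul_le_mul_of_nonneg_left h₁ hw₁
  have k₂ := mul_le_mul_of_nonneg_left h₂ hw₂
  have : -(w₁ * v₁ + w₂ * v₂) = w₁ * (-v₁) + w₂ * (-v₂) := by ring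
  rw [this]
  calc w₁ * (-v₁) + w₂ * (-v₂) ≤ w₁ * c + w₂ * c := add_le_add k₁ k₂
    _ = c := by rw [← add_mul, hws, one_mul]

/-! ## §2 ONE certified family: `P` on the whole station segment, `Q` state-free -/

section StationP

variable {UA Umax p q n₁ n₂ : ℝ}

/-- **THE 3-D BOX FROM ONE CERTIFIED STATION FAMILY (`P`) AND THE STATE-FREE END SLOT (`Q`).** Station `0 < U_A ≤ U_max`, box
`[p, q] × [U_A, U_max] × [n₁, n₂]` (`p < q ≤ 0`, `0 ≤ n₁`, `n₂ < 2`); kinematic data at the slot `q`: `ν ≥ 0`, `B(q, ν) ≤ B`, `ν·n₂/2 + B ≤ c`. ONE density-indexed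
unconditional orbit-lower family `vP x s ≤ |D₄|⁻¹ Σ_γ Re ω_γ(−X₀(p, U_A))` on the station segment `s ∈ [p(2 − U_A/U_max), q]` (classes at `(s, U_A, x)`), with
`−vP x s ≤ c`. Then `ObsStiffnessSeqCeilingAt t′ U x c` on the whole box — `ObsStiffnessSeqCeilingAt_on_box_of_apexStation_twoEndObjectives` at each density
with `vQ :=` the constant `−c` (§1). [cite: KomaTasaki1994, §1] [cite: ScalapinoWhiteZhang1993, §II] [cite: LiebLoss1993, §8, Theorem 8.2] -/
theorem ObsStiffnessSeqCeilingAt_on_box3_of_apexStation_stationP_kinQ (hUA : 0 < UA) (hq : q ≤ 0) (hpq : p < q) (hn₁ : 0 ≤ n₁)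
    (hn₂ : n₂ < 2) {ν B : ℝ} (hν : 0 ≤ ν)
    (hB : (∫ y in (-π)..π, ∫ x in (-π)..π,
        max (Real.cos x + Real.cos y + 4 * q * (Real.cos x * Real.cos y) - ν) 0) / (4 * π ^ 2) ≤ B)
    (vP : ℝ → ℝ → ℝ) (c : ℚ) (hkin : ν * n₂ / 2 + B ≤ ((c : ℚ) : ℝ))
    (hP : ∀ x ∈ Set.Icc n₁ n₂, ∀ s ∈ Set.Icc (p * (2 - UA / Umax)) q,
      ∀ (ω : InfVolFermionState 2) (Ls : ℕ → ℕ) (ψ : ∀ L, Fock (Orb (FermionTorus 2 L))),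
      Tendsto Ls atTop atTop →
      (∀ j, IsGroundStateInSector (hubbardTorusTT' (Ls j) 1 s UA) (rectN x (Ls j)) 0 (ψ (Ls j))) →
      (∀ j, star (ψ (Ls j)) ⬝ᵥ ψ (Ls j) = 1) → ω.IsTorusLimitOf ψ Ls →
      vP x s ≤ ((Finset.univ : Finset (DihedralGroup 4)).card : ℝ)⁻¹ * ∑ g ∈ (Finset.univ : Finset (DihedralGroup 4)),
        (ω.expect (d4ShiftSet g 0 (Literature.Probability.LatticeModels.box 2 7))
          (fermionEmbed (PolySite.d4Emb g 0 (Literature.Probability.LatticeModels.box 2 7)) (-oddMomentObsTT p UA 0))).re)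
    (hcP : ∀ x ∈ Set.Icc n₁ n₂, ∀ s ∈ Set.Icc (p * (2 - UA / Umax)) q, -vP x s ≤ ((c : ℚ) : ℝ)) :
    ∀ tp ∈ Set.Icc p q, ∀ U ∈ Set.Icc UA Umax, ∀ x ∈ Set.Icc n₁ n₂, ObsStiffnessSeqCeilingAt tp U x c := by
  intro tp htp U hU x hx
  have hUmax : UA ≤ Umax := hU.1.trans hU.2
  have hf : 0 ≤ 2 - UA / Umax := by
    have : UA / Umax ≤ 1 := (div_le_one (hUA.trans_le hUmax)).2 hUmax
    linarith
  refine ObsStiffnessSeqCeilingAt_on_box_of_apexStation_twoEndObjectives hUA hq hpq (hn₁.trans hx.1) (lt_of_le_of_lt hx.2 hn₂)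
    (vP x) (fun _ => -((c : ℚ) : ℝ)) c (hP x hx)
    (fun s _ ω Ls ψ hLs hψ h1 hω => orbitMean_endSlot_ge_neg_of_halfBathtub_le q UA s UA hν hB hn₂ hkin (hn₁.trans hx.1) hx.2
      ω Ls ψ hLs hψ h1 hω)
    (fun σ hσ s hs => ?_) tp htp U hU
  obtain ⟨hw₁, hw₂, hws, -, -⟩ := tPrimeSegment_weights hpq hσ.1 hσ.2
  have hseg : s ∈ Set.Icc (p * (2 - UA / Umax)) q := ⟨(mul_le_mul_of_nonneg_right hσ.1 hf).trans hs.1, hs.2.trans hσ.2⟩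
  exact neg_chord_le hw₁ hw₂ hws (hcP x hx s hseg) (by rw [neg_neg])

end StationP

/-! ## §3 TWO certified families: `P` on the overhang, the OWN word (or `P`) on the inner segment, `Q` state-free -/

section OverhangInner

variable {UA Umax p q n₁ n₂ : ℝ}

/-- **THE 3-D BOX FROM `P` ON THE OVERHANG AND THE OWN WORD ON THE INNER SEGMENT, `Q` STATE-FREE.** Station `0 < U_A ≤ U_max`, box
`[p, q] × [U_A, U_max] × [n₁, n₂]` (`p < q ≤ 0`, `0 ≤ n₁`, `n₂ < 2`); kinematic data at the slot `q` (`ν ≥ 0`, `B(q, ν) ≤ B`, `ν·n₂/2 + B ≤ c`). Families: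
`vP x s ≤` orbit mean of `−X₀(p, U_A)` on the OVERHANG `s ∈ [p(2 − U_A/U_max), p]`, and `vO x s ≤` orbit mean of the OWN objective `−X₀(s, U_A)` on the INNER
segment `s ∈ [p, q]`; prices `−vP x s ≤ c`, `−vO x s ≤ c`. Then `ObsStiffnessSeqCeilingAt t′ U x c` on the whole box: an overhang source words every slot
`σ ∈ [p, q]` as the chord of `P` and the state-free `Q`; an inner source `s` words its slots `σ ∈ [s, q]` as the chord of the slots `s` (own word) and `q`
(`orbitLower_slot_chord_of_two_endObjectives` with `p := s`; at `s = q` the own word IS the target objective). No `K₂` word, no lever.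
[cite: KomaTasaki1994, §1] [cite: ScalapinoWhiteZhang1993, §II] [cite: LiebLoss1993, §8, Theorem 8.2] -/
theorem ObsStiffnessSeqCeilingAt_on_box3_of_apexStation_overhangP_innerOwn_kinQ (hUA : 0 < UA) (hUmax : UA ≤ Umax) (hq : q ≤ 0)
    (hpq : p < q) (hn₁ : 0 ≤ n₁) (hn₂ : n₂ < 2) {ν B : ℝ} (hν : 0 ≤ ν)
    (hB : (∫ y in (-π)..π, ∫ x in (-π)..π,
        max (Real.cos x + Real.cos y + 4 * q * (Real.cos x * Real.cos y) - ν) 0) / (4 * π ^ 2) ≤ B)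
    (vP vO : ℝ → ℝ → ℝ) (c : ℚ) (hkin : ν * n₂ / 2 + B ≤ ((c : ℚ) : ℝ))
    (hP : ∀ x ∈ Set.Icc n₁ n₂, ∀ s ∈ Set.Icc (p * (2 - UA / Umax)) p,
      ∀ (ω : InfVolFermionState 2) (Ls : ℕ → ℕ) (ψ : ∀ L, Fock (Orb (FermionTorus 2 L))),
      Tendsto Ls atTop atTop →
      (∀ j, IsGroundStateInSector (hubbardTorusTT' (Ls j) 1 s UA) (rectN x (Ls j)) 0 (ψ (Ls j))) →
      (∀ j, star (ψ (Ls j)) ⬝ᵥ ψ (Ls j) = 1) → ω.IsTorusLimitOf ψ Ls →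
      vP x s ≤ ((Finset.univ : Finset (DihedralGroup 4)).card : ℝ)⁻¹ * ∑ g ∈ (Finset.univ : Finset (DihedralGroup 4)),
        (ω.expect (d4ShiftSet g 0 (Literature.Probability.LatticeModels.box 2 7))
          (fermionEmbed (PolySite.d4Emb g 0 (Literature.Probability.LatticeModels.box 2 7)) (-oddMomentObsTT p UA 0))).re)
    (hO : ∀ x ∈ Set.Icc n₁ n₂, ∀ s ∈ Set.Icc p q,
      ∀ (ω : InfVolFermionState 2) (Ls : ℕ → ℕ) (ψ : ∀ L, Fock (Orb (FermionTorus 2 L))),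
      Tendsto Ls atTop atTop →
      (∀ j, IsGroundStateInSector (hubbardTorusTT' (Ls j) 1 s UA) (rectN x (Ls j)) 0 (ψ (Ls j))) →
      (∀ j, star (ψ (Ls j)) ⬝ᵥ ψ (Ls j) = 1) → ω.IsTorusLimitOf ψ Ls →
      vO x s ≤ ((Finset.univ : Finset (DihedralGroup 4)).card : ℝ)⁻¹ * ∑ g ∈ (Finset.univ : Finset (DihedralGroup 4)),
        (ω.expect (d4ShiftSet g 0 (Literature.Probability.LatticeModels.box 2 7))
          (fermionEmbed (PolySite.d4Emb g 0 (Literature.Probability.LatticeModels.box 2 7)) (-oddMomentObsTT s UA 0))).re)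
    (hcP : ∀ x ∈ Set.Icc n₁ n₂, ∀ s ∈ Set.Icc (p * (2 - UA / Umax)) p, -vP x s ≤ ((c : ℚ) : ℝ))
    (hcO : ∀ x ∈ Set.Icc n₁ n₂, ∀ s ∈ Set.Icc p q, -vO x s ≤ ((c : ℚ) : ℝ)) :
    ∀ tp ∈ Set.Icc p q, ∀ U ∈ Set.Icc UA Umax, ∀ x ∈ Set.Icc n₁ n₂, ObsStiffnessSeqCeilingAt tp U x c := by
  have hf : 0 ≤ 2 - UA / Umax := by
    have : UA / Umax ≤ 1 := (div_le_one (hUA.trans_le hUmax)).2 hUmax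
    linarith
  have hcQ : -(-((c : ℚ) : ℝ)) ≤ ((c : ℚ) : ℝ) := by rw [neg_neg]
  refine ObsStiffnessSeqCeilingAt_on_box3_of_apexStation_targetSlot hUA hq hn₁ hn₂
    (fun x σ s => if s ≤ p then (q - σ) / (q - p) * vP x s + (σ - p) / (q - p) * (-((c : ℚ) : ℝ))
      else if s < q then (q - σ) / (q - s) * vO x s + (σ - s) / (q - s) * (-((c : ℚ) : ℝ)) else vO x s) c ?_ ?_
  · intro x hx σ hσ s hs ω Ls ψ hLs hψ h1 hω
    have hQ := orbitMean_endSlot_ge_neg_of_halfBathtub_le q UA s UA hν hB hn₂ hkin (hn₁.trans hx.1) hx.2 ω Ls ψ hLs hψ h1 hω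
    by_cases h3 : s ≤ p
    · simp only [if_pos h3]
      have hs' : s ∈ Set.Icc (p * (2 - UA / Umax)) p := ⟨(mul_le_mul_of_nonneg_right hσ.1 hf).trans hs.1, h3⟩
      exact orbitLower_slot_chord_of_two_endObjectives hω.isTranslationInvariant UA hpq hσ (hP x hx s hs' ω Ls ψ hLs hψ h1 hω) hQ
    · simp only [if_neg h3]
      have h3' : p < s := not_le.1 h3
      have hs' : s ∈ Set.Icc p q := ⟨h3'.le, hs.2.trans hσ.2⟩
      by_cases h4 : s < q
      · simp only [if_pos h4]
        exact orbitLower_slot_chord_of_two_endObjectives hω.isTranslationInvariant UA (p := s) (q := q) h4 ⟨hs.2, hσ.2⟩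
          (hO x hx s hs' ω Ls ψ hLs hψ h1 hω) hQ
      · simp only [if_neg h4]
        have e : σ = s := le_antisymm (hσ.2.trans (not_lt.1 h4)) hs.2
        rw [e]
        exact hO x hx s hs' ω Ls ψ hLs hψ h1 hω
  · intro x hx σ hσ s hs
    by_cases h3 : s ≤ p
    · simp only [if_pos h3]
      have hs' : s ∈ Set.Icc (p * (2 - UA / Umax)) p := ⟨(mul_le_mul_of_nonneg_right hσ.1 hf).trans hs.1, h3⟩
      obtain ⟨hw₁, hw₂, hws, -, -⟩ := tPrimeSegment_weights hpq hσ.1 hσ.2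
      exact neg_chord_le hw₁ hw₂ hws (hcP x hx s hs') hcQ
    · simp only [if_neg h3]
      have h3' : p < s := not_le.1 h3
      have hs' : s ∈ Set.Icc p q := ⟨h3'.le, hs.2.trans hσ.2⟩
      by_cases h4 : s < q
      · simp only [if_pos h4]
        obtain ⟨hw₁, hw₂, hws, -, -⟩ := tPrimeSegment_weights h4 hs.2 hσ.2
        exact neg_chord_le hw₁ hw₂ hws (hcO x hx s hs') hcQ
      · simp only [if_neg h4]
        exact hcO x hx s hs'

/-- **The `P`-on-inner edition**: as `…_overhangP_innerOwn_kinQ` with a `P = −X₀(p, U_A)` family `vI` on the inner segment `s ∈ [p, q]` instead of the own word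
(every slot is the chord of `p` and the state-free `q`). [cite: KomaTasaki1994, §1] [cite: ScalapinoWhiteZhang1993, §II] [cite: LiebLoss1993, §8, Theorem 8.2] -/
theorem ObsStiffnessSeqCeilingAt_on_box3_of_apexStation_overhangP_innerP_kinQ (hUA : 0 < UA) (hUmax : UA ≤ Umax) (hq : q ≤ 0)
    (hpq : p < q) (hn₁ : 0 ≤ n₁) (hn₂ : n₂ < 2) {ν B : ℝ} (hν : 0 ≤ ν)
    (hB : (∫ y in (-π)..π, ∫ x in (-π)..π,
        max (Real.cos x + Real.cos y + 4 * q * (Real.cos x * Real.cos y) - ν) 0) / (4 * π ^ 2) ≤ B)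
    (vP vI : ℝ → ℝ → ℝ) (c : ℚ) (hkin : ν * n₂ / 2 + B ≤ ((c : ℚ) : ℝ))
    (hP : ∀ x ∈ Set.Icc n₁ n₂, ∀ s ∈ Set.Icc (p * (2 - UA / Umax)) p,
      ∀ (ω : InfVolFermionState 2) (Ls : ℕ → ℕ) (ψ : ∀ L, Fock (Orb (FermionTorus 2 L))),
      Tendsto Ls atTop atTop →
      (∀ j, IsGroundStateInSector (hubbardTorusTT' (Ls j) 1 s UA) (rectN x (Ls j)) 0 (ψ (Ls j))) →
      (∀ j, star (ψ (Ls j)) ⬝ᵥ ψ (Ls j) = 1) → ω.IsTorusLimitOf ψ Ls →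
      vP x s ≤ ((Finset.univ : Finset (DihedralGroup 4)).card : ℝ)⁻¹ * ∑ g ∈ (Finset.univ : Finset (DihedralGroup 4)),
        (ω.expect (d4ShiftSet g 0 (Literature.Probability.LatticeModels.box 2 7))
          (fermionEmbed (PolySite.d4Emb g 0 (Literature.Probability.LatticeModels.box 2 7)) (-oddMomentObsTT p UA 0))).re)
    (hI : ∀ x ∈ Set.Icc n₁ n₂, ∀ s ∈ Set.Icc p q,
      ∀ (ω : InfVolFermionState 2) (Ls : ℕ → ℕ) (ψ : ∀ L, Fock (Orb (FermionTorus 2 L))),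
      Tendsto Ls atTop atTop →
      (∀ j, IsGroundStateInSector (hubbardTorusTT' (Ls j) 1 s UA) (rectN x (Ls j)) 0 (ψ (Ls j))) →
      (∀ j, star (ψ (Ls j)) ⬝ᵥ ψ (Ls j) = 1) → ω.IsTorusLimitOf ψ Ls →
      vI x s ≤ ((Finset.univ : Finset (DihedralGroup 4)).card : ℝ)⁻¹ * ∑ g ∈ (Finset.univ : Finset (DihedralGroup 4)),
        (ω.expect (d4ShiftSet g 0 (Literature.Probability.LatticeModels.box 2 7))
          (fermionEmbed (PolySite.d4Emb g 0 (Literature.Probability.LatticeModels.box 2 7)) (-oddMomentObsTT p UA 0))).re)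
    (hcP : ∀ x ∈ Set.Icc n₁ n₂, ∀ s ∈ Set.Icc (p * (2 - UA / Umax)) p, -vP x s ≤ ((c : ℚ) : ℝ))
    (hcI : ∀ x ∈ Set.Icc n₁ n₂, ∀ s ∈ Set.Icc p q, -vI x s ≤ ((c : ℚ) : ℝ)) :
    ∀ tp ∈ Set.Icc p q, ∀ U ∈ Set.Icc UA Umax, ∀ x ∈ Set.Icc n₁ n₂, ObsStiffnessSeqCeilingAt tp U x c := by
  have hf : 0 ≤ 2 - UA / Umax := by
    have : UA / Umax ≤ 1 := (div_le_one (hUA.trans_le hUmax)).2 hUmax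
    linarith
  -- one `P` family on the whole station segment, pieced from the two
  refine ObsStiffnessSeqCeilingAt_on_box3_of_apexStation_stationP_kinQ hUA hq hpq hn₁ hn₂ hν hB
    (fun x s => if s ≤ p then vP x s else vI x s) c hkin ?_ ?_
  · intro x hx s hs ω Ls ψ hLs hψ h1 hω
    by_cases h3 : s ≤ p
    · simp only [if_pos h3]; exact hP x hx s ⟨hs.1, h3⟩ ω Ls ψ hLs hψ h1 hω
    · simp only [if_neg h3]; exact hI x hx s ⟨(not_le.1 h3).le, hs.2⟩ ω Ls ψ hLs hψ h1 hω
  · intro x hx s hs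
    by_cases h3 : s ≤ p
    · simp only [if_pos h3]; exact hcP x hx s ⟨hs.1, h3⟩
    · simp only [if_neg h3]; exact hcI x hx s ⟨(not_le.1 h3).le, hs.2⟩

end OverhangInner

end Summit.Ventures.CertifiedManyBodySolver.Downfold

end
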